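import Mathlib
import HarnessLib
import Summits.HubbardSuperconductivity.HubbardSuperconductivity.Theorems.KLProgrammeKLRegimeTwoCutoffResponseStep
import Literature.MathematicalPhysics.QuantumLattice.GrassmannEffectiveActionBoundDB
import Literature.MathematicalPhysics.QuantumLattice.GrassmannGramBoundedSum
import Literature.MathematicalPhysics.QuantumLattice.GrassmannGramBoundedWeights
import Literature.MathematicalPhysics.QuantumLattice.GrassmannDefectSplit

/-!
# Route `KLProgramme` — crux K3, VL child `KLRegimeVolumeLimitV17F2` (stmt-HubbardSuperconductivity-20440), ROUTE A bracket (A4) COMPOSED: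
# the one-volume FRAME-RESPONSE bracket as a pinned kernel-difference bound from Gram data
# (cell gate-hubbard-kl, seat hubbard-kl-k3c5-p3 g9, technique «OS-positivity-free direct assembly»)

Under scheme F the two nested volumes `L ∣ L″` run their flows in their OWN frames `K_n^{(L)} ≠ K_n^{(L″)}`; the two-bracket inductive step
[tree] `…TwoVolumeInductiveStep.sum_norm_kernel_twoVolume_step_le` (k3c4-p1, p539598) compares the towers at ONE fine covariance `C′` whose
periodisation is the coarse one (`hP`), i.e. at a COMMON frame.  The third bracket of every scale `n ≥ 1` is therefore a ONE-volume comparison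
`effAction (C + E) W − effAction C W` of the effective actions at two frames, `E = Sᵀ(C^{K′}_{>Λ} − C^{K}_{>Λ})S` the frame defect, whose row/column
sums and entries are `O((Σ_{j<n} c_j)/L)` by [tree] `…TwoVolumeFrameDefect.rowSum_/colSum_/norm_frameDefect_…_of_towerV17F2` (this seat, p542415).
This file COMPOSES that datum with k3c4-p2's covariance-response (Polchinski) step [tree]
`…TwoCutoffResponseStep.sum_norm_kernel_effAction_add_sub_le_of_rowSums` exactly as k3c5-p2's response door (p533565) does for the near block
defect: the kernel data of `effAction (C + tE) W` along the straight path and the non-vanishing of its partition function come from the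
determinant-bounded single-scale step [tree] `sum_norm_kernel_effAction_le_of_gramBounded` (Gram PROPERTY of `C + tE`, row/column sums, the
UNWEIGHTED pinned profile `N` of `W`, one smallness `θ < 1`).  No decay, no zone, no nilpotency index: the pin is arbitrary.

* §1 `isGramBoundedR_add_smul_sub` — `C + t•(C′ − C) = (1−t)•C + t•C′` is replica-Gram-bounded with constant `κ + κ′` for `t ∈ [0,1]`;
  row/column sums along the path (`sum_norm_add_smul_row_le`).
* §2 **`effAction_path_of_gramBounded`** — along the path: unit partition functions and the pinned profile `≤ B(m) = ρ⁻ᵐ·e·normV/(1−θ)`;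
  **`sum_norm_kernel_effAction_add_sub_le_response_of_gramBounded`** — THE FRAME-RESPONSE BRACKET:
  `Σ_{X : X_p = w} ‖kernel (effAction (C+E) W) (n+1) X − kernel (effAction C W) (n+1) X‖`
  `≤ C(n+3,2)·sE·B(n+3) + ‖2⁻¹‖·Σ_{a+b=n+1}(a+1)(b+1)·(cR + cC)·B(a+1)·B(b+1)`,
  `sE` the entry sup, `cR/cC` the row/column sums of `E`, `B` at `α := αC + (cR + cC)`.
* §3 glued form: the same bracket read on the fine labels through the block copies `Σ_β map (F β) ·` at a fine pin `w′` IS the coarse bracket at the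
  reduced pin `(e w′).2` (`sum_norm_kernel_copies_sub_copies_eq`), for use when the frame change is placed on the coarse side of the step.

Proofs only; no definition; nothing is asserted about the model (the model instance `E := Sᵀ(C^{K′}_{>Λ} − C^{K}_{>Λ})S` with the tower's
`O(1/L)` data is the sequel `…TwoVolumeFrameResponseModel`).  References: BGM 2006 §2–§3 ((2.13)–(2.14), (2.77)–(2.80)); Salmhofer 1999
(2.102)–(2.106) (Polchinski's equation); GK 1985 §3.
-/

noncomputable section

namespace Summit.HubbardSuperconductivity.HubbardSuperconductivity.Theorems.TwoVolumeDefect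

set_option linter.dupNamespace false -- summit = problem name (single-conjunct summit), D-0017

open Finset Literature.MathematicalPhysics.QuantumLattice GrassmannAlgebra
open scoped Nat

variable {𝕜 : Type*} [RCLike 𝕜]

/-! ## §1 The straight path between two covariances: Gram property and row sums -/

section Path

variable {Γ : Type} [Fintype Γ] [DecidableEq Γ]

omit [Fintype Γ] [DecidableEq Γ] in
/-- `C + t•(C′ − C) = (1 − t)•C + t•C′`. [folklore] -/
theorem add_smul_sub_eq_convex (C C' : Matrix Γ Γ 𝕜) (t : ℝ) : C + t • (C' - C) = (1 - t) • C + t • C' := by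
  ext X Y
  simp only [Matrix.add_apply, Matrix.smul_apply, Matrix.sub_apply, smul_sub, sub_smul, one_smul]
  abel

omit [Fintype Γ] [DecidableEq Γ] in
/-- **The straight path between two replica-Gram-bounded covariances is replica-Gram-bounded** with constant `κ + κ′`, uniformly in `t ∈ [0,1]`
(`(1−t)•C` and `t•C′` keep their constants, [tree] `isGramBoundedR_real_smul`; sum by `IsGramBoundedR.add`). [cite: BenfattoGiulianiMastropietro2006, (2.67) and (2.80)] -/
theorem isGramBoundedR_add_smul_sub {C C' : Matrix Γ Γ 𝕜} {κ κ' : ℝ} (hC : IsGramBoundedR C κ) (hC' : IsGramBoundedR C' κ') (hκ : 0 ≤ κ)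
    {t : ℝ} (ht : t ∈ Set.Icc (0 : ℝ) 1) : IsGramBoundedR (C + t • (C' - C)) (κ + κ') := by
  rw [add_smul_sub_eq_convex]
  exact (isGramBoundedR_real_smul hC (by linarith [ht.2]) (by linarith [ht.1])).add (isGramBoundedR_real_smul hC' ht.1 ht.2) hκ

omit [DecidableEq Γ] in
/-- Row sums along the path: `Σ_Y ‖(C + t•E) X Y‖ ≤ αC + cR` for `t ∈ [0,1]`. [folklore] -/
theorem sum_norm_add_smul_row_le (C E : Matrix Γ Γ 𝕜) {αC cR : ℝ} (hrow : ∀ X, ∑ Y, ‖C X Y‖ ≤ αC) (hR : ∀ X, ∑ Y, ‖E X Y‖ ≤ cR)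
    {t : ℝ} (ht : t ∈ Set.Icc (0 : ℝ) 1) (X : Γ) : ∑ Y, ‖(C + t • E) X Y‖ ≤ αC + cR := by
  calc ∑ Y, ‖(C + t • E) X Y‖ ≤ ∑ Y, (‖C X Y‖ + ‖E X Y‖) := by
        refine sum_le_sum fun Y _ => ?_
        rw [Matrix.add_apply, Matrix.smul_apply]
        refine (norm_add_le _ _).trans (add_le_add le_rfl ?_)
        rw [norm_smul, Real.norm_eq_abs, abs_of_nonneg ht.1]
        exact mul_le_of_le_one_left (norm_nonneg _) ht.2
    _ ≤ αC + cR := by rw [sum_add_distrib]; exact add_le_add (hrow X) (hR X)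

omit [DecidableEq Γ] in
/-- Column sums along the path: `Σ_X ‖(C + t•E) X Y‖ ≤ αC + cC` for `t ∈ [0,1]`. [folklore] -/
theorem sum_norm_add_smul_col_le (C E : Matrix Γ Γ 𝕜) {αC cC : ℝ} (hcol : ∀ Y, ∑ X, ‖C X Y‖ ≤ αC) (hC : ∀ Y, ∑ X, ‖E X Y‖ ≤ cC)
    {t : ℝ} (ht : t ∈ Set.Icc (0 : ℝ) 1) (Y : Γ) : ∑ X, ‖(C + t • E) X Y‖ ≤ αC + cC := by
  have h := sum_norm_add_smul_row_le (𝕜 := 𝕜) C.transpose E.transpose (αC := αC) (cR := cC)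
    (fun X => by simpa [Matrix.transpose_apply] using hcol X) (fun X => by simpa [Matrix.transpose_apply] using hC X) ht Y
  simpa [Matrix.transpose_apply, Matrix.add_apply, Matrix.smul_apply] using h

end Path

/-! ## §2 The frame-response bracket from Gram data -/

section Response

variable {Γ : Type} [LinearOrder Γ] [Fintype Γ]

/-- **Along the straight path `C + tE`, `t ∈ [0,1]`**: with the Gram property `IsGramBoundedR (C + tE) κ`, row/column sums of `C` `≤ αC` and of `E`
`≤ cR / cC`, the UNWEIGHTED pinned profile `N` of the even interaction `W` and `θ = e·(αC + (cR + cC))·normV(κ,ρ,N)/κ² < 1`: the partition function of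
`(C + tE, W)` is a unit and every pinned kernel sum of `effAction (C + tE) W` in degree `m ≥ 1` is `≤ ρ⁻ᵐ·e·normV/(1−θ)`
([tree] `sum_norm_kernel_effAction_le_of_gramBounded`). [cite: BenfattoGiulianiMastropietro2006, (2.13)-(2.14) and (2.77)-(2.80)] -/
theorem effAction_path_of_gramBounded (C E : Matrix Γ Γ 𝕜) (W : GrassmannAlgebra 𝕜 Γ) (hWe : W ∈ evenPart 𝕜 Γ) (hW0 : constPart 𝕜 W = 0)
    (N : ℕ → ℝ) (hN0 : ∀ m', 0 ≤ N m')
    (hN : ∀ m' (j : Fin (2 * m')) (x : Γ), ∑ Y ∈ univ.filter (fun Y : Fin (2 * m') → Γ => Y j = x), ‖kernel 𝕜 W (2 * m') Y‖ ≤ N m')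
    {κ : ℝ} (hκ : 0 < κ) (hGB : ∀ t ∈ Set.Icc (0 : ℝ) 1, IsGramBoundedR (C + t • E) κ)
    {αC : ℝ} (hαC : 0 < αC) (hrow : ∀ X, ∑ Y, ‖C X Y‖ ≤ αC) (hcol : ∀ Y, ∑ X, ‖C X Y‖ ≤ αC)
    {cR cC : ℝ} (hcR : 0 ≤ cR) (hcC : 0 ≤ cC) (hR : ∀ X, ∑ Y, ‖E X Y‖ ≤ cR) (hC : ∀ Y, ∑ X, ‖E X Y‖ ≤ cC)
    {ρ : ℝ} (hρ : 0 < ρ) (hθ : Real.exp 1 * (αC + (cR + cC)) * normV Γ κ ρ N / κ ^ 2 < 1)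
    {t : ℝ} (ht : t ∈ Set.Icc (0 : ℝ) 1) :
    IsUnit (effPartitionFn 𝕜 (C + t • E) W) ∧ ∀ {m : ℕ}, 0 < m → ∀ (i : Fin m) (x : Γ),
      ∑ X ∈ univ.filter (fun X : Fin m → Γ => X i = x), ‖kernel 𝕜 (effAction 𝕜 (C + t • E) W) m X‖ ≤
        ρ⁻¹ ^ m * (Real.exp 1 * normV Γ κ ρ N) / (1 - Real.exp 1 * (αC + (cR + cC)) * normV Γ κ ρ N / κ ^ 2) := by
  classical
  have hα : 0 < αC + (cR + cC) := by linarith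
  have hrowt : ∀ X, ∑ Y, ‖(C + t • E) X Y‖ ≤ αC + (cR + cC) := fun X =>
    (sum_norm_add_smul_row_le C E hrow hR ht X).trans (by linarith)
  have hcolt : ∀ Y, ∑ X, ‖(C + t • E) X Y‖ ≤ αC + (cR + cC) := fun Y =>
    (sum_norm_add_smul_col_le C E hcol hC ht Y).trans (by linarith)
  exact sum_norm_kernel_effAction_le_of_gramBounded (C + t • E) hκ (hGB t ht) W hWe hW0 N hN0 hN hα hrowt hcolt hρ hθ

/-- **THE FRAME-RESPONSE BRACKET FROM GRAM DATA** ((A4) composed).  For covariances `C`, `C + E` on one label set, an even interaction `W`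
without constant part and with UNWEIGHTED pinned profile `N`, the Gram property of the straight path `IsGramBoundedR (C + tE) κ` (`t ∈ [0,1]`),
row/column sums of `C` `≤ αC`, and the defect's data — entry sup `sE`, row sums `cR`, column sums `cC` — with ONE smallness
`θ = e·(αC + (cR + cC))·normV(κ,ρ,N)/κ² < 1`, at every pin `(p, w)` and degree `n + 1`:
`Σ_{X : X_p = w} ‖kernel (effAction (C + E) W) (n+1) X − kernel (effAction C W) (n+1) X‖`
`≤ C(n+3,2)·sE·B(n+3) + ‖2⁻¹‖·Σ_{a+b=n+1}(a+1)(b+1)·(cR·B(a+1)B(b+1) + cC·B(a+1)B(b+1))`, `B(m) = ρ⁻ᵐ·e·normV/(1−θ)`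
(k3c4-p2's response step `sum_norm_kernel_effAction_add_sub_le_of_rowSums` fed by `effAction_path_of_gramBounded`).
[cite: BenfattoGiulianiMastropietro2006, (2.13)-(2.14) and (2.77)-(2.80)] -/
theorem sum_norm_kernel_effAction_add_sub_le_response_of_gramBounded (C E : Matrix Γ Γ 𝕜) (W : GrassmannAlgebra 𝕜 Γ)
    (hWe : W ∈ evenPart 𝕜 Γ) (hW0 : constPart 𝕜 W = 0) (N : ℕ → ℝ) (hN0 : ∀ m', 0 ≤ N m')
    (hN : ∀ m' (j : Fin (2 * m')) (x : Γ), ∑ Y ∈ univ.filter (fun Y : Fin (2 * m') → Γ => Y j = x), ‖kernel 𝕜 W (2 * m') Y‖ ≤ N m')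
    {κ : ℝ} (hκ : 0 < κ) (hGB : ∀ t ∈ Set.Icc (0 : ℝ) 1, IsGramBoundedR (C + t • E) κ)
    {αC : ℝ} (hαC : 0 < αC) (hrow : ∀ X, ∑ Y, ‖C X Y‖ ≤ αC) (hcol : ∀ Y, ∑ X, ‖C X Y‖ ≤ αC)
    {sE : ℝ} (hsE : ∀ X Y, ‖E X Y‖ ≤ sE)
    {cR cC : ℝ} (hcR : 0 ≤ cR) (hcC : 0 ≤ cC) (hR : ∀ X, ∑ Y, ‖E X Y‖ ≤ cR) (hC : ∀ Y, ∑ X, ‖E X Y‖ ≤ cC)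
    {ρ : ℝ} (hρ : 0 < ρ) (hθ : Real.exp 1 * (αC + (cR + cC)) * normV Γ κ ρ N / κ ^ 2 < 1)
    (w : Γ) (n : ℕ) (p : Fin (n + 1)) :
    ∑ X ∈ univ.filter (fun X : Fin (n + 1) → Γ => X p = w),
        ‖kernel 𝕜 (effAction 𝕜 (C + E) W) (n + 1) X - kernel 𝕜 (effAction 𝕜 C W) (n + 1) X‖ ≤
      (((n + 1 + 1) * (n + 1 + 2) : ℕ) : ℝ) / 2 * sE *
          (ρ⁻¹ ^ (n + 3) * (Real.exp 1 * normV Γ κ ρ N) / (1 - Real.exp 1 * (αC + (cR + cC)) * normV Γ κ ρ N / κ ^ 2)) +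
        ‖(2 : 𝕜)⁻¹‖ * ∑ a ∈ range (n + 2), ∑ b ∈ range (n + 2),
          (if a + b = n + 1 then (((a + 1) * (b + 1) : ℕ) : ℝ) *
            (cR * (ρ⁻¹ ^ (a + 1) * (Real.exp 1 * normV Γ κ ρ N) / (1 - Real.exp 1 * (αC + (cR + cC)) * normV Γ κ ρ N / κ ^ 2)) *
                (ρ⁻¹ ^ (b + 1) * (Real.exp 1 * normV Γ κ ρ N) / (1 - Real.exp 1 * (αC + (cR + cC)) * normV Γ κ ρ N / κ ^ 2)) +
              cC * (ρ⁻¹ ^ (a + 1) * (Real.exp 1 * normV Γ κ ρ N) / (1 - Real.exp 1 * (αC + (cR + cC)) * normV Γ κ ρ N / κ ^ 2)) *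
                (ρ⁻¹ ^ (b + 1) * (Real.exp 1 * normV Γ κ ρ N) / (1 - Real.exp 1 * (αC + (cR + cC)) * normV Γ κ ρ N / κ ^ 2))) else 0) := by
  classical
  set θ : ℝ := Real.exp 1 * (αC + (cR + cC)) * normV Γ κ ρ N / κ ^ 2 with hθ_def
  set B : ℕ → ℝ := fun m => ρ⁻¹ ^ m * (Real.exp 1 * normV Γ κ ρ N) / (1 - θ) with hB_def
  have hnormV0 : 0 ≤ normV Γ κ ρ N := normV_nonneg hκ.le hρ.le hN0
  have hB0 : ∀ m, 0 ≤ B m := fun m => by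
    have : 0 < 1 - θ := by linarith
    positivity
  -- the path data
  have hpath : ∀ t ∈ Set.Icc (0 : ℝ) 1, IsUnit (effPartitionFn 𝕜 (C + t • E) W) ∧ ∀ {m : ℕ}, 0 < m → ∀ (i : Fin m) (x : Γ),
      ∑ X ∈ univ.filter (fun X : Fin m → Γ => X i = x), ‖kernel 𝕜 (effAction 𝕜 (C + t • E) W) m X‖ ≤ B m := by
    intro t ht
    have h := effAction_path_of_gramBounded C E W hWe hW0 N hN0 hN hκ hGB hαC hrow hcol hcR hcC hR hC hρ hθ ht
    exact ⟨h.1, fun hm i x => by simpa only [hB_def, hθ_def] using h.2 hm i x⟩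
  have hZ : ∀ t ∈ Set.Icc (0 : ℝ) 1, effPartitionFn 𝕜 (C + (t : ℝ) • E) W ≠ 0 := fun t ht => (hpath t ht).1.ne_zero
  have hV0 : ∀ t ∈ Set.Icc (0 : ℝ) 1, ∀ (m : ℕ) (x : Γ),
      ∑ U ∈ univ.filter (fun U : Fin (m + 1) → Γ => U 0 = x), ‖kernel 𝕜 (effAction 𝕜 (C + (t : ℝ) • E) W) (m + 1) U‖ ≤ B (m + 1) :=
    fun t ht m x => (hpath t ht).2 (Nat.succ_pos m) 0 x
  have hVt : ∀ t ∈ Set.Icc (0 : ℝ) 1, ∀ (m : ℕ) (i : Fin m),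
      ∑ U ∈ univ.filter (fun U : Fin (m + 1) → Γ => U i.succ = w), ‖kernel 𝕜 (effAction 𝕜 (C + (t : ℝ) • E) W) (m + 1) U‖ ≤ B (m + 1) :=
    fun t ht m i => (hpath t ht).2 (Nat.succ_pos m) i.succ w
  have hVL : ∀ t ∈ Set.Icc (0 : ℝ) 1,
      ∑ Z ∈ univ.filter (fun Z : Fin (n + 1 + 1 + 1) → Γ => Z (Fin.castSucc (Fin.castSucc p)) = w),
        ‖kernel 𝕜 (effAction 𝕜 (C + (t : ℝ) • E) W) (n + 1 + 2) Z‖ ≤ B (n + 3) :=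
    fun t ht => (hpath t ht).2 (by omega) (Fin.castSucc (Fin.castSucc p)) w
  have h := sum_norm_kernel_effAction_add_sub_le_of_rowSums C E W hW0 (mem_evenPart_iff.1 hWe) hZ hsE hcR hcC hR hC w B B B hB0 hB0
    hV0 hVt n p hVL
  simpa only [hB_def, hθ_def] using h

/-- **Both endpoint partition functions are units** under the hypotheses of the frame-response bracket (`t = 0` and `t = 1` of
`effAction_path_of_gramBounded`): the data needed to chain the bracket with the semigroup `effAction_add`. [folklore] -/
theorem isUnit_effPartitionFn_endpoints_of_gramBounded (C E : Matrix Γ Γ 𝕜) (W : GrassmannAlgebra 𝕜 Γ)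
    (hWe : W ∈ evenPart 𝕜 Γ) (hW0 : constPart 𝕜 W = 0) (N : ℕ → ℝ) (hN0 : ∀ m', 0 ≤ N m')
    (hN : ∀ m' (j : Fin (2 * m')) (x : Γ), ∑ Y ∈ univ.filter (fun Y : Fin (2 * m') → Γ => Y j = x), ‖kernel 𝕜 W (2 * m') Y‖ ≤ N m')
    {κ : ℝ} (hκ : 0 < κ) (hGB : ∀ t ∈ Set.Icc (0 : ℝ) 1, IsGramBoundedR (C + t • E) κ)
    {αC : ℝ} (hαC : 0 < αC) (hrow : ∀ X, ∑ Y, ‖C X Y‖ ≤ αC) (hcol : ∀ Y, ∑ X, ‖C X Y‖ ≤ αC)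
    {cR cC : ℝ} (hcR : 0 ≤ cR) (hcC : 0 ≤ cC) (hR : ∀ X, ∑ Y, ‖E X Y‖ ≤ cR) (hC : ∀ Y, ∑ X, ‖E X Y‖ ≤ cC)
    {ρ : ℝ} (hρ : 0 < ρ) (hθ : Real.exp 1 * (αC + (cR + cC)) * normV Γ κ ρ N / κ ^ 2 < 1) :
    IsUnit (effPartitionFn 𝕜 C W) ∧ IsUnit (effPartitionFn 𝕜 (C + E) W) := by
  have h0 := (effAction_path_of_gramBounded C E W hWe hW0 N hN0 hN hκ hGB hαC hrow hcol hcR hcC hR hC hρ hθ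
    (t := 0) ⟨le_rfl, zero_le_one⟩).1
  have h1 := (effAction_path_of_gramBounded C E W hWe hW0 N hN0 hN hκ hGB hαC hrow hcol hcR hcC hR hC hρ hθ
    (t := 1) ⟨zero_le_one, le_rfl⟩).1
  rw [zero_smul, add_zero] at h0
  rw [one_smul] at h1
  exact ⟨h0, h1⟩

end Response

/-! ## §3 The glued form: a coarse one-volume bracket read on the fine labels through the block copies -/

section Glued

variable {Γ ι : Type*} [Fintype Γ] [DecidableEq Γ] [Fintype ι] [DecidableEq ι] {Γ' : Type*} [Fintype Γ'] [DecidableEq Γ']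

/-- **Pinned kernel sums of a glued DIFFERENCE are the coarse pinned sums at the reduced pin**: for the block copies
`Glue A := Σ_β map (F β) A` of `…GrassmannEffectiveActionCopies`, `Σ_{X′ : X′_j = w′} ‖kernel (Glue A − Glue B) m X′‖ =
Σ_{X : X_j = (e w′).2} ‖kernel (A − B) m X‖` — so a ONE-volume frame-response bracket proved for the coarse actions transports verbatim to
the fine algebra (the case where the frame change of the scale is placed on the coarse side of the two-volume step).
[cite: BenfattoGiulianiMastropietro2006, (2.13)-(2.14)] -/
theorem sum_norm_kernel_copies_sub_copies_eq (e : Γ' ≃ ι × Γ) (F : ι → (Γ → 𝕜) →ₗ[𝕜] (Γ' → 𝕜))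
    (hF : ∀ β v X', F β v X' = if (e X').1 = β then v (e X').2 else 0) (A B : GrassmannAlgebra 𝕜 Γ) {m : ℕ} (j : Fin m) (w' : Γ') :
    ∑ X' ∈ univ.filter (fun X' : Fin m → Γ' => X' j = w'),
        ‖kernel 𝕜 (∑ β, ExteriorAlgebra.map (F β) A) m X' - kernel 𝕜 (∑ β, ExteriorAlgebra.map (F β) B) m X'‖ =
      ∑ X ∈ univ.filter (fun X : Fin m → Γ => X j = (e w').2), ‖kernel 𝕜 A m X - kernel 𝕜 B m X‖ := by
  have hglue : (∑ β, ExteriorAlgebra.map (F β) A) - (∑ β, ExteriorAlgebra.map (F β) B) = ∑ β, ExteriorAlgebra.map (F β) (A - B) := by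
    rw [← sum_sub_distrib]
    exact sum_congr rfl fun β _ => (map_sub _ _ _).symm
  have hk : ∀ X' : Fin m → Γ', kernel 𝕜 (∑ β, ExteriorAlgebra.map (F β) A) m X' - kernel 𝕜 (∑ β, ExteriorAlgebra.map (F β) B) m X' =
      kernel 𝕜 (∑ β, ExteriorAlgebra.map (F β) (A - B)) m X' := fun X' => by
    rw [← hglue, kernel_sub']
  simp_rw [hk]
  rw [sum_pinned_kernel_copies_sum e F hF (A - B) j w' (fun _ r => ‖r‖) (fun _ => norm_zero)]
  refine sum_congr rfl fun X _ => ?_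
  rw [kernel_sub']

end Glued

end Summit.HubbardSuperconductivity.HubbardSuperconductivity.Theorems.TwoVolumeDefect
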